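import Summits.QuantumFields.YangMills.Theorems.ColdStartUniversalityLatticeLangevinLiebRobinsonLightCone
import Summits.QuantumFields.YangMills.Theorems.ColdStartUniversalityLatticeLangevinLiebRobinsonWordMixing
import HarnessLib

/-!
# Route `ColdStartUniversality` (fixed-cut-off SZZ dynamics; LIEB–ROBINSON / LOCALITY package, file 12):
# the light cone of a FIXED WILSON LOOP WORD — at every coupling, in every volume

Helper file (seat `ym-line-csu-p1`, g30; `--supports stmt-QuantumFields-24809`).  The concrete instance of `…LiebRobinsonLightCone` for the
observables physicists look at: `Re tr w` for a word `w` of link matrices / adjoints at a FIXED position (a plaquette, an `R × T` loop; no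
spatial average), `SU(2)` SZZ dynamics on `(ℤ/L)³` at ANY coupling `β'`, `λ = |β'|(4+4√2+12·108)`:
* ★★ `word_linkLipschitz_profile` — `Re tr w ∘ coords` is `2π|w|`-Lipschitz in each link of the word and does not depend on the other links
  (carré bound `Γ^A(Re tr w) ≤ 32|w|²` + the one-link oscillation lemma; locality of words);
* ★★★ `word_lightCone` — two starts that agree on every link within cyclic sup-distance `R` of the links of `w` give
  `|κ_t(Re tr w)(y) − κ_t(Re tr w)(y')| ≤ 24√2·π·|w|²·e^(λt)·2^(−(R+1))`: before lattice time `≈ (R+1)·log 2/λ` the loop does not feel what the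
  start looks like at distance `> R` — uniformly in `L`; ★★ `word_lightCone_le` (the `δ`-form); ★★★ `solution_word_lightCone` (two strong
  solutions on possibly different filtered probability spaces, e.g. the COLD start versus a start modified far from the loop).
THEOREMS ONLY, no definition, no sorry; [folklore].  HONEST FRAMING: fixed cut-off; every `β'` but slope `λ ∝ |β'|`, so in the route's scaling
`β'_K = (γε_K)⁻¹/2 → ∞` nothing here is `K`-uniform in physical units; `UniformColdStartMixing` (24809) is NOT restated; no crux, rung or
summit statement is proved; the Yang–Mills mass gap is NOT proved.
-/

set_option autoImplicit false

noncomputable section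

namespace Summit.QuantumFields.YangMills.Theorems.ColdStartUniversality.LiebRobinson

open MeasureTheory ProbabilityTheory Matrix Complex Finset Filter Set Metric
open scoped ComplexConjugate BigOperators Matrix NNReal ENNReal Topology
open Literature.Probability.Process Literature.MathematicalPhysics.QuantumFieldTheory
open Literature.MathematicalPhysics.QuantumFieldTheory.Balaban1983to89
open Literature.MathematicalPhysics.QuantumLattice (fundamentalRep fundamentalLatticeRep continuous_fundamentalRep fundamentalRep_apply)

variable {L : ℕ} [NeZero L]

/-! ## §1. The link-Lipschitz profile of a word -/

/-- ★★ **The link-Lipschitz profile of a Wilson loop word** (flat-coordinate form `Re tr w ∘ coords`): `2π|w|` in every link occurring in the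
word, `0` in every other link.  (`Γ^A(Re tr w) ≤ 32|w|² = (4√2|w|)²`, `wilson_word_carre_le`; one-link oscillation `(π/(2√2))·σ`,
`oscillation_oneLink_le_of_carre_le`; locality `word_coords_local`.) [folklore] -/
theorem word_linkLipschitz_profile (L : ℕ) [NeZero L] (β' : ℝ) (l : List (Edge 3 L × Bool)) :
    let coords : GaugeConfig 3 L (Matrix.specialUnitaryGroup (Fin 2) ℂ) → (Edge 3 L × Fin 2 × Fin 2 × Bool → ℝ) :=
      fun V q => (fun z : ℂ => if q.2.2.2 then z.im else z.re)
        ((fundamentalRep (Fin 2) (V q.1) : Matrix (Fin 2) (Fin 2) ℂ) q.2.1 q.2.2.1)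
    ∀ (e : Edge 3 L) (y y' : (GaugeConfig 3 L (Matrix.specialUnitaryGroup (Fin 2) ℂ))), (∀ f, f ≠ e → y f = y' f) →
      |(fun y : (Edge 3 L × Fin 2 × Fin 2 × Bool → ℝ) => ((l.map (fun a : Edge 3 L × Bool => if a.2 then ((fun (ee : Edge 3 L) => Matrix.of fun (i j : Fin 2) => ((y (ee, i, j, false) : ℝ) : ℂ) + ((y (ee, i, j, true) : ℝ) : ℂ) * Complex.I) a.1)ᴴ else (fun (ee : Edge 3 L) => Matrix.of fun (i j : Fin 2) => ((y (ee, i, j, false) : ℝ) : ℂ) + ((y (ee, i, j, true) : ℝ) : ℂ) * Complex.I) a.1)).prod).trace.re) (coords y) - (fun y : (Edge 3 L × Fin 2 × Fin 2 × Bool → ℝ) => ((l.map (fun a : Edge 3 L × Bool => if a.2 then ((fun (ee : Edge 3 L) => Matrix.of fun (i j : Fin 2) => ((y (ee, i, j, false) : ℝ) : ℂ) + ((y (ee, i, j, true) : ℝ) : ℂ) * Complex.I) a.1)ᴴ else (fun (ee : Edge 3 L) => Matrix.of fun (i j : Fin 2) => ((y (ee, i, j, false) : ℝ) : ℂ) +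 ((y (ee, i, j, true) : ℝ) : ℂ) * Complex.I) a.1)).prod).trace.re) (coords y')| ≤
        (if e ∈ (l.map Prod.fst).toFinset then 2 * Real.pi * (l.length : ℝ) else 0) * frobNorm ((y e : Matrix (Fin 2) (Fin 2) ℂ) - (y' e : Matrix (Fin 2) (Fin 2) ℂ)) := by
  intro coords e y y' hyy'
  classical
  have hσ : (0 : ℝ) ≤ 4 * Real.sqrt 2 * (l.length : ℝ) := by positivity
  have hsq : (4 * Real.sqrt 2 * (l.length : ℝ)) ^ 2 = 32 * (l.length : ℝ) ^ 2 := by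
    rw [mul_pow, mul_pow, Real.sq_sqrt (by norm_num : (0:ℝ) ≤ 2)]; ring
  have hΓ := wilson_word_carre_le L β' l
  by_cases he : e ∈ (l.map Prod.fst).toFinset
  · rw [if_pos he]
    have h := oscillation_oneLink_le_of_carre_le L β' ((contDiff_word (L := L) l (m := 1))) hσ e
      (fun x => by rw [hsq]; exact hΓ x) y' y (fun f hf => hyy' f hf)
    have hc : Real.pi / (2 * Real.sqrt 2) * (4 * Real.sqrt 2 * (l.length : ℝ)) = 2 * Real.pi * (l.length : ℝ) := by
      have h2 : (2 * Real.sqrt 2 : ℝ) ≠ 0 := by positivity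
      field_simp
      ring
    rw [hc] at h
    exact h
  · rw [if_neg he, zero_mul]
    have hagree : ∀ e' ∈ (l.map Prod.fst).toFinset, y e' = y' e' := fun e' he' => hyy' e' (fun h => he (h ▸ he'))
    have hloc := word_coords_local (L := L) l y y' hagree
    rw [hloc, sub_self, abs_zero]

/-! ## §2. The light cone of a word -/

/-- ★★★ **The light cone of a fixed Wilson loop word** (every coupling `β'`, every volume `L`): for every word `w`, every realising kernel
family, every `t`, every `R` and all starts `y, y'` that agree on every link whose base site is within cyclic sup-distance `R` of the base
site of a link of `w`: `|κ_t(Re tr w)(y) − κ_t(Re tr w)(y')| ≤ 24√2·π·|w|²·e^(λt)·2^(−(R+1))`, `λ = |β'|(4+4√2+12·108)`. [folklore] -/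
theorem word_lightCone (L : ℕ) [NeZero L] (β' : ℝ)
    (κ : ℝ≥0 → Kernel (GaugeConfig 3 L (Matrix.specialUnitaryGroup (Fin 2) ℂ))
      (GaugeConfig 3 L (Matrix.specialUnitaryGroup (Fin 2) ℂ))) [∀ t, IsMarkovKernel (κ t)]
    (hreal : ∀ (t : ℝ≥0) (x : GaugeConfig 3 L (Matrix.specialUnitaryGroup (Fin 2) ℂ))
        (Ω : Type) [MeasurableSpace Ω] (P : Measure Ω) [IsProbabilityMeasure P]
        (W : ℝ≥0 → Ω → (Edge 3 L × NoiseIdx 2 → ℝ)) (hW : IsFlatBrownian W P)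
        (U : ℝ≥0 → Ω → GaugeConfig 3 L (Matrix.specialUnitaryGroup (Fin 2) ℂ)),
        (∀ ω, U 0 ω = x) →
        (latticeLangevinDynamics (fundamentalLatticeRep 2) β').IsSolution (fundamentalRep (Fin 2))
          hW.natFiltration P W U →
        κ t x = P.map (U t))
    (l : List (Edge 3 L × Bool)) (t : ℝ≥0) (R : ℕ) (y y' : (GaugeConfig 3 L (Matrix.specialUnitaryGroup (Fin 2) ℂ)))
    (hyy' : ∀ e₀ : Edge 3 L, (∃ e ∈ (l.map Prod.fst).toFinset, (Finset.univ.sup fun i : Fin 3 => ((e.1 i - e₀.1 i).valMinAbs).natAbs) ≤ R) → y e₀ = y' e₀) :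
    let coords : GaugeConfig 3 L (Matrix.specialUnitaryGroup (Fin 2) ℂ) → (Edge 3 L × Fin 2 × Fin 2 × Bool → ℝ) :=
      fun V q => (fun z : ℂ => if q.2.2.2 then z.im else z.re)
        ((fundamentalRep (Fin 2) (V q.1) : Matrix (Fin 2) (Fin 2) ℂ) q.2.1 q.2.2.1)
    |∫ z, (fun y : (Edge 3 L × Fin 2 × Fin 2 × Bool → ℝ) => ((l.map (fun a : Edge 3 L × Bool => if a.2 then ((fun (ee : Edge 3 L) => Matrix.of fun (i j : Fin 2) => ((y (ee, i, j, false) : ℝ) : ℂ) + ((y (ee, i, j, true) : ℝ) : ℂ) * Complex.I) a.1)ᴴ else (fun (ee : Edge 3 L) => Matrix.of fun (i j : Fin 2) => ((y (ee, i, j, false) : ℝ) : ℂ) + ((y (ee, i, j, true) : ℝ) : ℂ) * Complex.I) a.1)).prod).trace.re) (coords z) ∂(κ t y) - ∫ z, (fun y : (Edge 3 L × Fin 2 × Fin 2 × Bool → ℝ) => ((l.map (fun a : Edge 3 L × Bool => if a.2 then ((fun (ee : Edge 3 L) => Matrix.of fun (i j : Fin 2) => ((y (ee, i, j, false) : ℝ)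 : ℂ) + ((y (ee, i, j, true) : ℝ) : ℂ) * Complex.I) a.1)ᴴ else (fun (ee : Edge 3 L) => Matrix.of fun (i j : Fin 2) => ((y (ee, i, j, false) : ℝ) : ℂ) + ((y (ee, i, j, true) : ℝ) : ℂ) * Complex.I) a.1)).prod).trace.re) (coords z) ∂(κ t y')| ≤
      24 * Real.sqrt 2 * Real.pi * (l.length : ℝ) ^ 2 * Real.exp ((|β'| * (4 + 4 * Real.sqrt 2 + 12 * 108)) * (t : ℝ)) * ((2 : ℝ)⁻¹) ^ (R + 1) := by
  intro coords
  classical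
  set ℓ : Edge 3 L → ℝ := fun e => if e ∈ (l.map Prod.fst).toFinset then 2 * Real.pi * (l.length : ℝ) else 0 with hℓ
  have hℓ0 : ∀ e, 0 ≤ ℓ e := fun e => by
    simp only [hℓ]; split_ifs
    · positivity
    · exact le_rfl
  have hℓΛ : ∀ e, e ∉ (l.map Prod.fst).toFinset → ℓ e = 0 := fun e he => by simp only [hℓ, he, if_false]
  have hprof := word_linkLipschitz_profile L β' l
  have hF : ∀ (e : Edge 3 L) (z z' : (GaugeConfig 3 L (Matrix.specialUnitaryGroup (Fin 2) ℂ))), (∀ f, f ≠ e → z f = z' f) →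
      |(fun u : (GaugeConfig 3 L (Matrix.specialUnitaryGroup (Fin 2) ℂ)) => (fun y : (Edge 3 L × Fin 2 × Fin 2 × Bool → ℝ) => ((l.map (fun a : Edge 3 L × Bool => if a.2 then ((fun (ee : Edge 3 L) => Matrix.of fun (i j : Fin 2) => ((y (ee, i, j, false) : ℝ) : ℂ) + ((y (ee, i, j, true) : ℝ) : ℂ) * Complex.I) a.1)ᴴ else (fun (ee : Edge 3 L) => Matrix.of fun (i j : Fin 2) => ((y (ee, i, j, false) : ℝ) : ℂ) + ((y (ee, i, j, true) : ℝ) : ℂ) * Complex.I) a.1)).prod).trace.re) (coords u)) z - (fun u : (GaugeConfig 3 L (Matrix.specialUnitaryGroup (Fin 2) ℂ)) => (fun y : (Edge 3 L × Fin 2 × Fin 2 × Bool → ℝ) => ((l.map (fun a : Edge 3 L × Bool => if a.2 then ((fun (ee : Edge 3 L) => Matrix.of fun (i j : Fin 2) => ((y (ee, i, j, false) : ℝ) : ℂ) + ((y (ee, i, j, true) : ℝ) : ℂ) * Complex.I) a.1)ᴴ else (fun (ee : Edge 3 L) => Matrix.of fun (i j : Fin 2) => ((y (ee, i, j, false) :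 ℝ) : ℂ) + ((y (ee, i, j, true) : ℝ) : ℂ) * Complex.I) a.1)).prod).trace.re) (coords u)) z'| ≤ ℓ e * frobNorm ((z e : Matrix (Fin 2) (Fin 2) ℂ) - (z' e : Matrix (Fin 2) (Fin 2) ℂ)) :=
    fun e z z' h => hprof e z z' h
  have hFc : Continuous fun u : (GaugeConfig 3 L (Matrix.specialUnitaryGroup (Fin 2) ℂ)) => (fun y : (Edge 3 L × Fin 2 × Fin 2 × Bool → ℝ) => ((l.map (fun a : Edge 3 L × Bool => if a.2 then ((fun (ee : Edge 3 L) => Matrix.of fun (i j : Fin 2) => ((y (ee, i, j, false) : ℝ) : ℂ) + ((y (ee, i, j, true) : ℝ) : ℂ) * Complex.I) a.1)ᴴ else (fun (ee : Edge 3 L) => Matrix.of fun (i j : Fin 2) => ((y (ee, i, j, false) : ℝ) : ℂ) + ((y (ee, i, j, true) : ℝ) : ℂ) * Complex.I) a.1)).prod).trace.re) (coords u) :=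
    (contDiff_word (L := L) l (m := 1)).continuous.comp (continuous_coords (L := L))
  have h := transitionKernel_lightCone L β' κ hreal hFc hℓ0 hF (l.map Prod.fst).toFinset hℓΛ t R y y' hyy'
  have hcard : (((l.map Prod.fst).toFinset.card : ℕ) : ℝ) ≤ l.length := by
    have h1 := List.toFinset_card_le (l.map Prod.fst)
    rw [List.length_map] at h1
    exact_mod_cast h1
  have hsum : ∑ e : Edge 3 L, ℓ e ≤ 2 * Real.pi * (l.length : ℝ) ^ 2 := by
    have hs : ∑ e : Edge 3 L, ℓ e = ((l.map Prod.fst).toFinset.card : ℝ) * (2 * Real.pi * (l.length : ℝ)) := by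
      simp only [hℓ]
      rw [Finset.sum_ite_mem, Finset.univ_inter, Finset.sum_const, nsmul_eq_mul]
    rw [hs]
    calc ((l.map Prod.fst).toFinset.card : ℝ) * (2 * Real.pi * (l.length : ℝ)) ≤ (l.length : ℝ) * (2 * Real.pi * (l.length : ℝ)) :=
          mul_le_mul_of_nonneg_right hcard (by positivity)
      _ = 2 * Real.pi * (l.length : ℝ) ^ 2 := by ring
  calc |∫ z, (fun y : (Edge 3 L × Fin 2 × Fin 2 × Bool → ℝ) => ((l.map (fun a : Edge 3 L × Bool => if a.2 then ((fun (ee : Edge 3 L) => Matrix.of fun (i j : Fin 2) => ((y (ee, i, j, false) : ℝ) : ℂ) + ((y (ee, i, j, true) : ℝ) : ℂ) * Complex.I) a.1)ᴴ else (fun (ee : Edge 3 L) => Matrix.of fun (i j : Fin 2) => ((y (ee, i, j, false) : ℝ) : ℂ) + ((y (ee, i, j, true) : ℝ) : ℂ) * Complex.I) a.1)).prod).trace.re) (coords z) ∂(κ t y) - ∫ z, (fun y : (Edge 3 L × Fin 2 × Fin 2 × Bool → ℝ) => ((l.map (fun a : Edge 3 L × Bool => if a.2 then ((fun (ee : Edge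 3 L) => Matrix.of fun (i j : Fin 2) => ((y (ee, i, j, false) : ℝ) : ℂ) + ((y (ee, i, j, true) : ℝ) : ℂ) * Complex.I) a.1)ᴴ else (fun (ee : Edge 3 L) => Matrix.of fun (i j : Fin 2) => ((y (ee, i, j, false) : ℝ) : ℂ) + ((y (ee, i, j, true) : ℝ) : ℂ) * Complex.I) a.1)).prod).trace.re) (coords z) ∂(κ t y')|
      ≤ 12 * Real.sqrt 2 * Real.exp ((|β'| * (4 + 4 * Real.sqrt 2 + 12 * 108)) * (t : ℝ)) * ((2 : ℝ)⁻¹) ^ (R + 1) * ∑ e : Edge 3 L, ℓ e := h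
    _ ≤ 12 * Real.sqrt 2 * Real.exp ((|β'| * (4 + 4 * Real.sqrt 2 + 12 * 108)) * (t : ℝ)) * ((2 : ℝ)⁻¹) ^ (R + 1) * (2 * Real.pi * (l.length : ℝ) ^ 2) :=
        mul_le_mul_of_nonneg_left hsum (by positivity)
    _ = 24 * Real.sqrt 2 * Real.pi * (l.length : ℝ) ^ 2 * Real.exp ((|β'| * (4 + 4 * Real.sqrt 2 + 12 * 108)) * (t : ℝ)) * ((2 : ℝ)⁻¹) ^ (R + 1) := by ring

/-- ★★ **`δ`-form**: with `C_w = 24√2·π·|w|²`, if `(R+1)·log 2 ≥ λt + log(C_w/δ)` then the two expectations differ by at most `δ`. [folklore] -/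
theorem word_lightCone_le (L : ℕ) [NeZero L] (β' : ℝ)
    (κ : ℝ≥0 → Kernel (GaugeConfig 3 L (Matrix.specialUnitaryGroup (Fin 2) ℂ))
      (GaugeConfig 3 L (Matrix.specialUnitaryGroup (Fin 2) ℂ))) [∀ t, IsMarkovKernel (κ t)]
    (hreal : ∀ (t : ℝ≥0) (x : GaugeConfig 3 L (Matrix.specialUnitaryGroup (Fin 2) ℂ))
        (Ω : Type) [MeasurableSpace Ω] (P : Measure Ω) [IsProbabilityMeasure P]
        (W : ℝ≥0 → Ω → (Edge 3 L × NoiseIdx 2 → ℝ)) (hW : IsFlatBrownian W P)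
        (U : ℝ≥0 → Ω → GaugeConfig 3 L (Matrix.specialUnitaryGroup (Fin 2) ℂ)),
        (∀ ω, U 0 ω = x) →
        (latticeLangevinDynamics (fundamentalLatticeRep 2) β').IsSolution (fundamentalRep (Fin 2))
          hW.natFiltration P W U →
        κ t x = P.map (U t))
    (l : List (Edge 3 L × Bool)) (t : ℝ≥0) (R : ℕ) {δ : ℝ} (hδ : 0 < δ)
    (hR : (|β'| * (4 + 4 * Real.sqrt 2 + 12 * 108)) * (t : ℝ) + Real.log (24 * Real.sqrt 2 * Real.pi * (l.length : ℝ) ^ 2 / δ) ≤ ((R : ℝ) + 1) * Real.log 2)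
    (y y' : (GaugeConfig 3 L (Matrix.specialUnitaryGroup (Fin 2) ℂ))) (hyy' : ∀ e₀ : Edge 3 L, (∃ e ∈ (l.map Prod.fst).toFinset, (Finset.univ.sup fun i : Fin 3 => ((e.1 i - e₀.1 i).valMinAbs).natAbs) ≤ R) → y e₀ = y' e₀) :
    let coords : GaugeConfig 3 L (Matrix.specialUnitaryGroup (Fin 2) ℂ) → (Edge 3 L × Fin 2 × Fin 2 × Bool → ℝ) :=
      fun V q => (fun z : ℂ => if q.2.2.2 then z.im else z.re)
        ((fundamentalRep (Fin 2) (V q.1) : Matrix (Fin 2) (Fin 2) ℂ) q.2.1 q.2.2.1)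
    |∫ z, (fun y : (Edge 3 L × Fin 2 × Fin 2 × Bool → ℝ) => ((l.map (fun a : Edge 3 L × Bool => if a.2 then ((fun (ee : Edge 3 L) => Matrix.of fun (i j : Fin 2) => ((y (ee, i, j, false) : ℝ) : ℂ) + ((y (ee, i, j, true) : ℝ) : ℂ) * Complex.I) a.1)ᴴ else (fun (ee : Edge 3 L) => Matrix.of fun (i j : Fin 2) => ((y (ee, i, j, false) : ℝ) : ℂ) + ((y (ee, i, j, true) : ℝ) : ℂ) * Complex.I) a.1)).prod).trace.re) (coords z) ∂(κ t y) - ∫ z, (fun y : (Edge 3 L × Fin 2 × Fin 2 × Bool → ℝ) => ((l.map (fun a : Edge 3 L × Bool => if a.2 then ((fun (ee : Edge 3 L) => Matrix.of fun (i j : Fin 2) => ((y (ee, i, j, false) : ℝ) : ℂ) + ((y (ee, i, j, true) : ℝ) : ℂ) * Complex.I) a.1)ᴴ else (fun (ee : Edge 3 L) => Matrix.of fun (i j : Fin 2) => ((y (ee, i, j, false) : ℝ) : ℂ) + ((y (ee, i, j, true) : ℝ) : ℂ) * Complex.I) a.1)).prod).trace.re) (coords z) ∂(κ t y')| ≤ δ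 := by
  intro coords
  have h := word_lightCone L β' κ hreal l t R y y' hyy'
  refine h.trans ?_
  set C : ℝ := 24 * Real.sqrt 2 * Real.pi * (l.length : ℝ) ^ 2 with hC
  have hC0 : 0 ≤ C := by rw [hC]; positivity
  have hpow : ((2 : ℝ)⁻¹) ^ (R + 1) = Real.exp (-(((R : ℝ) + 1) * Real.log 2)) := by
    rw [Real.exp_neg, show ((R : ℝ) + 1) = ((R + 1 : ℕ) : ℝ) by push_cast; ring, Real.exp_nat_mul,
      Real.exp_log (by norm_num : (0 : ℝ) < 2), inv_pow]
  have hre : 24 * Real.sqrt 2 * Real.pi * (l.length : ℝ) ^ 2 * Real.exp ((|β'| * (4 + 4 * Real.sqrt 2 + 12 * 108)) * (t : ℝ)) * ((2 : ℝ)⁻¹) ^ (R + 1) =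
      C * Real.exp ((|β'| * (4 + 4 * Real.sqrt 2 + 12 * 108)) * (t : ℝ) - ((R : ℝ) + 1) * Real.log 2) := by
    rw [hpow, sub_eq_add_neg, Real.exp_add, hC]; ring
  rw [hre]
  rcases eq_or_lt_of_le hC0 with hC00 | hCpos
  · rw [← hC00, zero_mul]; exact hδ.le
  · have h1 : (|β'| * (4 + 4 * Real.sqrt 2 + 12 * 108)) * (t : ℝ) - ((R : ℝ) + 1) * Real.log 2 ≤ -Real.log (C / δ) := by linarith
    have h2 : Real.exp ((|β'| * (4 + 4 * Real.sqrt 2 + 12 * 108)) * (t : ℝ) - ((R : ℝ) + 1) * Real.log 2) ≤ δ / C := by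
      have := Real.exp_le_exp.2 h1
      rwa [Real.exp_neg, Real.exp_log (div_pos hCpos hδ), inv_div] at this
    calc C * Real.exp ((|β'| * (4 + 4 * Real.sqrt 2 + 12 * 108)) * (t : ℝ) - ((R : ℝ) + 1) * Real.log 2) ≤ C * (δ / C) := mul_le_mul_of_nonneg_left h2 hC0
      _ = δ := mul_div_cancel₀ δ hCpos.ne'

/-! ## §3. Along strong solutions -/

/-- ★★★ **The light cone of a fixed Wilson loop word along strong SZZ solutions** (every coupling, every volume): two strong solutions from
deterministic starts `y`, `y'` agreeing on the `R`-ball around the links of `w` (e.g. the COLD start and a start modified only far from the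
loop), on possibly different filtered probability spaces: `|E[Re tr w(U_t)] − E'[Re tr w(U'_t)]| ≤ 24√2·π·|w|²·e^(λt)·2^(−(R+1))`. [folklore] -/
theorem solution_word_lightCone (L : ℕ) [NeZero L] (β' : ℝ) (t : ℝ≥0) (l : List (Edge 3 L × Bool)) (R : ℕ) (y y' : (GaugeConfig 3 L (Matrix.specialUnitaryGroup (Fin 2) ℂ)))
    (hyy' : ∀ e₀ : Edge 3 L, (∃ e ∈ (l.map Prod.fst).toFinset, (Finset.univ.sup fun i : Fin 3 => ((e.1 i - e₀.1 i).valMinAbs).natAbs) ≤ R) → y e₀ = y' e₀)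
    (Ω : Type) [MeasurableSpace Ω] (P : Measure Ω) [IsProbabilityMeasure P]
    (W : ℝ≥0 → Ω → (Edge 3 L × NoiseIdx 2 → ℝ)) (hW : IsFlatBrownian W P)
    (U : ℝ≥0 → Ω → (GaugeConfig 3 L (Matrix.specialUnitaryGroup (Fin 2) ℂ))) (hU0 : ∀ ω, U 0 ω = y)
    (hU : (latticeLangevinDynamics (fundamentalLatticeRep 2) β').IsSolution (fundamentalRep (Fin 2)) hW.natFiltration P W U)
    (Ω' : Type) [MeasurableSpace Ω'] (P' : Measure Ω') [IsProbabilityMeasure P']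
    (W' : ℝ≥0 → Ω' → (Edge 3 L × NoiseIdx 2 → ℝ)) (hW' : IsFlatBrownian W' P')
    (U' : ℝ≥0 → Ω' → (GaugeConfig 3 L (Matrix.specialUnitaryGroup (Fin 2) ℂ))) (hU0' : ∀ ω, U' 0 ω = y')
    (hU' : (latticeLangevinDynamics (fundamentalLatticeRep 2) β').IsSolution (fundamentalRep (Fin 2)) hW'.natFiltration P' W' U') :
    let coords : GaugeConfig 3 L (Matrix.specialUnitaryGroup (Fin 2) ℂ) → (Edge 3 L × Fin 2 × Fin 2 × Bool → ℝ) :=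
      fun V q => (fun z : ℂ => if q.2.2.2 then z.im else z.re)
        ((fundamentalRep (Fin 2) (V q.1) : Matrix (Fin 2) (Fin 2) ℂ) q.2.1 q.2.2.1)
    |∫ ω, (fun y : (Edge 3 L × Fin 2 × Fin 2 × Bool → ℝ) => ((l.map (fun a : Edge 3 L × Bool => if a.2 then ((fun (ee : Edge 3 L) => Matrix.of fun (i j : Fin 2) => ((y (ee, i, j, false) : ℝ) : ℂ) + ((y (ee, i, j, true) : ℝ) : ℂ) * Complex.I) a.1)ᴴ else (fun (ee : Edge 3 L) => Matrix.of fun (i j : Fin 2) => ((y (ee, i, j, false) : ℝ) : ℂ) + ((y (ee, i, j, true) : ℝ) : ℂ) * Complex.I) a.1)).prod).trace.re) (coords (U t ω)) ∂P - ∫ ω, (fun y : (Edge 3 L × Fin 2 × Fin 2 × Bool → ℝ) => ((l.map (fun a : Edge 3 L × Bool => if a.2 then ((fun (ee : Edge 3 L) => Matrix.of fun (i j : Fin 2) => ((y (ee, i, j, false) : ℝ) : ℂ) + ((y (ee, i, j, true) : ℝ) : ℂ) * Complex.I) a.1)ᴴ else (fun (ee : Edge 3 L) => Matrix.of fun (i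 j : Fin 2) => ((y (ee, i, j, false) : ℝ) : ℂ) + ((y (ee, i, j, true) : ℝ) : ℂ) * Complex.I) a.1)).prod).trace.re) (coords (U' t ω)) ∂P'| ≤
      24 * Real.sqrt 2 * Real.pi * (l.length : ℝ) ^ 2 * Real.exp ((|β'| * (4 + 4 * Real.sqrt 2 + 12 * 108)) * (t : ℝ)) * ((2 : ℝ)⁻¹) ^ (R + 1) := by
  intro coords
  classical
  haveI := secondCountableTopology_su2
  haveI := borelSpace_config L
  obtain ⟨κ, hκ, -, hreal⟩ := exists_transitionKernel L β'
  haveI := hκ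
  have h := word_lightCone L β' κ hreal l t R y y' hyy'
  have hlaw : κ t y = P.map (U t) := hreal t y Ω P W hW U hU0 hU
  have hlaw' : κ t y' = P'.map (U' t) := hreal t y' Ω' P' W' hW' U' hU0' hU'
  have hmU : Measurable (U t) := (hU.adapted t).mono (hW.natFiltration.le t) le_rfl
  have hmU' : Measurable (U' t) := (hU'.adapted t).mono (hW'.natFiltration.le t) le_rfl
  have hFm : Measurable fun u : (GaugeConfig 3 L (Matrix.specialUnitaryGroup (Fin 2) ℂ)) => (fun y : (Edge 3 L × Fin 2 × Fin 2 × Bool → ℝ) => ((l.map (fun a : Edge 3 L × Bool => if a.2 then ((fun (ee : Edge 3 L) => Matrix.of fun (i j : Fin 2) => ((y (ee, i, j, false) : ℝ) : ℂ) + ((y (ee, i, j, true) : ℝ) : ℂ) * Complex.I) a.1)ᴴ else (fun (ee : Edge 3 L) => Matrix.of fun (i j : Fin 2) => ((y (ee, i, j, false) : ℝ) : ℂ) + ((y (ee, i, j, true) : ℝ) : ℂ) * Complex.I) a.1)).prod).trace.re) (coords u) :=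
    ((contDiff_word (L := L) l (m := 1)).continuous.comp (continuous_coords (L := L))).measurable
  have e1 : ∫ z, (fun y : (Edge 3 L × Fin 2 × Fin 2 × Bool → ℝ) => ((l.map (fun a : Edge 3 L × Bool => if a.2 then ((fun (ee : Edge 3 L) => Matrix.of fun (i j : Fin 2) => ((y (ee, i, j, false) : ℝ) : ℂ) + ((y (ee, i, j, true) : ℝ) : ℂ) * Complex.I) a.1)ᴴ else (fun (ee : Edge 3 L) => Matrix.of fun (i j : Fin 2) => ((y (ee, i, j, false) : ℝ) : ℂ) + ((y (ee, i, j, true) : ℝ) : ℂ) * Complex.I) a.1)).prod).trace.re) (coords z) ∂(κ t y) = ∫ ω, (fun y : (Edge 3 L × Fin 2 × Fin 2 × Bool → ℝ) => ((l.map (fun a : Edge 3 L × Bool => if a.2 then ((fun (ee : Edge 3 L) => Matrix.of fun (i j : Fin 2) => ((y (ee, i, j, false) : ℝ) : ℂ) + ((y (ee, i, j, true) : ℝ) : ℂ) * Complex.I) a.1)ᴴ else (fun (ee : Edge 3 L) => Matrix.of fun (i j : Fin 2) => ((y (ee, i, j, false) : ℝ) : ℂ) + ((y (ee, i, j, true)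 : ℝ) : ℂ) * Complex.I) a.1)).prod).trace.re) (coords (U t ω)) ∂P := by
    rw [hlaw, integral_map hmU.aemeasurable hFm.aestronglyMeasurable]
  have e2 : ∫ z, (fun y : (Edge 3 L × Fin 2 × Fin 2 × Bool → ℝ) => ((l.map (fun a : Edge 3 L × Bool => if a.2 then ((fun (ee : Edge 3 L) => Matrix.of fun (i j : Fin 2) => ((y (ee, i, j, false) : ℝ) : ℂ) + ((y (ee, i, j, true) : ℝ) : ℂ) * Complex.I) a.1)ᴴ else (fun (ee : Edge 3 L) => Matrix.of fun (i j : Fin 2) => ((y (ee, i, j, false) : ℝ) : ℂ) + ((y (ee, i, j, true) : ℝ) : ℂ) * Complex.I) a.1)).prod).trace.re) (coords z) ∂(κ t y') = ∫ ω, (fun y : (Edge 3 L × Fin 2 × Fin 2 × Bool → ℝ) => ((l.map (fun a : Edge 3 L × Bool => if a.2 then ((fun (ee : Edge 3 L) => Matrix.of fun (i j : Fin 2) => ((y (ee, i, j, false) : ℝ) : ℂ) + ((y (ee, i, j, true) : ℝ) : ℂ) * Complex.I) a.1)ᴴ else (fun (ee : Edge 3 L) => Matrix.of fun (i j : Fin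 2) => ((y (ee, i, j, false) : ℝ) : ℂ) + ((y (ee, i, j, true) : ℝ) : ℂ) * Complex.I) a.1)).prod).trace.re) (coords (U' t ω)) ∂P' := by
    rw [hlaw', integral_map hmU'.aemeasurable hFm.aestronglyMeasurable]
  rw [← e1, ← e2]
  exact h

end Summit.QuantumFields.YangMills.Theorems.ColdStartUniversality.LiebRobinson
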